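import Summits.RiemannHypothesis.RiemannHypothesis.Theorems.JensenPolynomialsSkewFarInterface
import Summits.RiemannHypothesis.RiemannHypothesis.Theorems.JensenPolynomialsXiCumulantIdentity
import Summits.RiemannHypothesis.RiemannHypothesis.Theses.JensenPolynomials

/-!
# Route `JensenPolynomials`, FAR crux `XiCumulantSkew98Far` PROVED: `q(M) = M·Ũ₃(M)² ≤ 81/2` for every `M ≥ 2·10¹⁸`
(RH-FREE proof-of-data; cell rh-jensen, HUMAN RULING D-0040)

ITEM CLOSER `xiCumulantSkew98Far_item : Theses.JensenPolynomials.XiCumulantSkew98Far` — the FAR skewness cap of the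
Hermite-frame window cumulants of `ξ`'s Taylor data (`Ũ₃ = hermiteCumulant xiTaylorCoeff M 3`), by the «Stein-moment line»
(parts 1–6b, `Theorems/JensenPolynomialsSkewFar*.lean`): with `a = a_{2M}` the mode of `u^{2M}Φ(u)`, `z = 1/(4a+1) ≤ 1/38.8`,
the window ↔ moment dictionary (rh-jensen-theory g7, LINE far-skew-moments §1/§4, kernel-checked there and re-proved here:
`r̃₂ = (m₂m₀/m₁²)(2M−3)/(2M−1)`, `r̃₃ = (m₃m₀²/m₁³)(2M−3)(2M−5)/(2M−1)²`, `2MΔ² = 1 + 1/(2b) − ((b−1)/b)(M v)`,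
`b²ũ₃ = 2 − 6((b−1)/M)(M v) + (b−1)(b−2)κ₃`, `ũ₃ = windowCumulant 3`, `b = M − ½`) and the interface
`1.99z ≤ M v ≤ 2.01z`, `0 ≤ (b−1)(b−2)κ₃ ≤ 0.07` (`far_interface`):
`δ = 2MΔ² ≥ 1 − 2.01z`, `0 < X = b²ũ₃ ≤ 2.07 − 11.88z`, `q = 8X²(M/b)⁴/δ³ ≤ 34.3 < 81/2` (truth `q ↑ 32`, eng-5 ET3).
NOTE: theory's stub T2 `M v ≥ 1/40` of that line is false for `M ≳ 10³⁶` (`M v ≈ 2/(4a+1) → 0`); the mode-dependent two-sided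
law replaces it. Axioms standard; import closure zero-free and height-free. WHAT THIS IS NOT: a statement about ratios of four
consecutive Taylor coefficients of `ξ`; nothing here bears on the zeros of `ζ`.
References: GORZ 2019 [GORZPNAS2019]; Griffin et al. 2022 (GORTTW) §2 [GriffinEtAl2022]; HOME:eng-5/ET3.md §8.
-/

noncomputable section
-- D-0017: `Summit.RiemannHypothesis.RiemannHypothesis.…` duplicates the namespace BY DESIGN (single-problem summit).
set_option linter.dupNamespace false

namespace Summit.RiemannHypothesis.RiemannHypothesis.Theorems.JensenPolynomials.SkewFar

open Literature.NumberTheory.LFunctions Literature.Probability.Distributions MeasureTheory Set Filter Real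
open scoped Topology Nat

/-! ## 1. Window ↔ moment dictionary (rh-jensen-theory g7, LINE far-skew-moments §1) -/

/-- factorial bookkeeping: `(n+1)! = (n+1)·n!` in `ℝ`. -/
theorem fac_succ_real (n : ℕ) : ((n + 1)! : ℝ) = (n + 1 : ℝ) * (n ! : ℝ) := by
  push_cast [Nat.factorial_succ]; ring

/-- `r̃₂(m+3) = (m₂m₀/m₁²)·(2m+3)/(2m+5)` with `m_j = xiMoment (2m + 6 − 2j)` (theory g7's `windowSeqDown_two_xi`). -/
theorem windowSeqDown_two_xi (m : ℕ) :
    windowSeqDown xiTaylorCoeff (m + 3) 2 =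
      xiMoment (2 * m + 2) * xiMoment (2 * m + 6) / xiMoment (2 * m + 4) ^ 2 * ((2 * m + 3 : ℝ) / (2 * m + 5)) := by
  unfold windowSeqDown
  have e0 : m + 3 - 2 = m + 1 := rfl
  have e1 : m + 3 - 1 = m + 2 := rfl
  rw [e0, e1, show (2 : ℕ) - 1 = 1 from rfl, pow_one,
    xiTaylorCoeff_eq_xiMoment (m + 1), xiTaylorCoeff_eq_xiMoment (m + 2), xiTaylorCoeff_eq_xiMoment (m + 3)]
  have h2 : 2 * (m + 1) = 2 * m + 2 := by ring
  have h4 : 2 * (m + 2) = 2 * m + 4 := by ring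
  have h6 : 2 * (m + 3) = 2 * m + 6 := by ring
  rw [h2, h4, h6]
  have f2 : ((m + 2)! : ℝ) = (m + 2 : ℝ) * ((m + 1)! : ℝ) := by
    rw [show m + 2 = (m + 1) + 1 from rfl, fac_succ_real]; push_cast; ring
  have f3 : ((m + 3)! : ℝ) = (m + 3 : ℝ) * (m + 2 : ℝ) * ((m + 1)! : ℝ) := by
    rw [show m + 3 = (m + 2) + 1 from rfl, fac_succ_real, f2]; push_cast; ring
  have g3 : ((2 * m + 3)! : ℝ) = (2 * m + 3 : ℝ) * ((2 * m + 2)! : ℝ) := by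
    rw [show 2 * m + 3 = (2 * m + 2) + 1 from rfl, fac_succ_real]; push_cast; ring
  have g4 : ((2 * m + 4)! : ℝ) = (2 * m + 4 : ℝ) * (2 * m + 3 : ℝ) * ((2 * m + 2)! : ℝ) := by
    rw [show 2 * m + 4 = (2 * m + 3) + 1 from rfl, fac_succ_real, g3]; push_cast; ring
  have g5 : ((2 * m + 5)! : ℝ) = (2 * m + 5 : ℝ) * (2 * m + 4 : ℝ) * (2 * m + 3 : ℝ) * ((2 * m + 2)! : ℝ) := by
    rw [show 2 * m + 5 = (2 * m + 4) + 1 from rfl, fac_succ_real, g4]; push_cast; ring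
  have g6 : ((2 * m + 6)! : ℝ) =
      (2 * m + 6 : ℝ) * (2 * m + 5 : ℝ) * (2 * m + 4 : ℝ) * (2 * m + 3 : ℝ) * ((2 * m + 2)! : ℝ) := by
    rw [show 2 * m + 6 = (2 * m + 5) + 1 from rfl, fac_succ_real, g5]; push_cast; ring
  rw [f2, f3, g4, g6]
  have hm1 : ((m + 1)! : ℝ) ≠ 0 := by positivity
  have hg2 : ((2 * m + 2)! : ℝ) ≠ 0 := by positivity
  have hx2 : xiMoment (2 * m + 2) ≠ 0 := (xiMoment_pos _).ne'
  have hx4 : xiMoment (2 * m + 4) ≠ 0 := (xiMoment_pos _).ne'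
  have hx6 : xiMoment (2 * m + 6) ≠ 0 := (xiMoment_pos _).ne'
  have h4p : (4 : ℝ) ^ (m + 1) ≠ 0 := by positivity
  have l2 : ((m : ℝ) + 2) ≠ 0 := by positivity
  have l3 : ((m : ℝ) + 3) ≠ 0 := by positivity
  have k3 : (2 * (m : ℝ) + 3) ≠ 0 := by positivity
  have k4 : (2 * (m : ℝ) + 4) ≠ 0 := by positivity
  have k5 : (2 * (m : ℝ) + 5) ≠ 0 := by positivity
  have k6 : (2 * (m : ℝ) + 6) ≠ 0 := by positivity
  rw [show (4 : ℝ) ^ (m + 2) = 4 ^ (m + 1) * 4 by ring, show (4 : ℝ) ^ (m + 3) = 4 ^ (m + 1) * 16 by ring]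
  field_simp
  ring

/-- `r̃₃(m+3) = (m₃m₀²/m₁³)·(2m+3)(2m+1)/(2m+5)²` (theory g7's `windowSeqDown_three_xi`). -/
theorem windowSeqDown_three_xi (m : ℕ) :
    windowSeqDown xiTaylorCoeff (m + 3) 3 =
      xiMoment (2 * m) * xiMoment (2 * m + 6) ^ 2 / xiMoment (2 * m + 4) ^ 3 *
        ((2 * m + 3 : ℝ) * (2 * m + 1) / (2 * m + 5) ^ 2) := by
  unfold windowSeqDown
  have e0 : m + 3 - 3 = m := rfl
  have e1 : m + 3 - 1 = m + 2 := rfl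
  rw [e0, e1, show (3 : ℕ) - 1 = 2 from rfl,
    xiTaylorCoeff_eq_xiMoment m, xiTaylorCoeff_eq_xiMoment (m + 2), xiTaylorCoeff_eq_xiMoment (m + 3)]
  have h4 : 2 * (m + 2) = 2 * m + 4 := by ring
  have h6 : 2 * (m + 3) = 2 * m + 6 := by ring
  rw [h4, h6]
  have f1 : ((m + 1)! : ℝ) = (m + 1 : ℝ) * (m ! : ℝ) := fac_succ_real m
  have f2 : ((m + 2)! : ℝ) = (m + 2 : ℝ) * (m + 1 : ℝ) * (m ! : ℝ) := by
    rw [show m + 2 = (m + 1) + 1 from rfl, fac_succ_real, f1]; push_cast; ring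
  have f3 : ((m + 3)! : ℝ) = (m + 3 : ℝ) * (m + 2 : ℝ) * (m + 1 : ℝ) * (m ! : ℝ) := by
    rw [show m + 3 = (m + 2) + 1 from rfl, fac_succ_real, f2]; push_cast; ring
  have g1 : ((2 * m + 1)! : ℝ) = (2 * m + 1 : ℝ) * ((2 * m)! : ℝ) := by
    rw [fac_succ_real]; push_cast; ring
  have g2 : ((2 * m + 2)! : ℝ) = (2 * m + 2 : ℝ) * (2 * m + 1 : ℝ) * ((2 * m)! : ℝ) := by
    rw [show 2 * m + 2 = (2 * m + 1) + 1 from rfl, fac_succ_real, g1]; push_cast; ring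
  have g3 : ((2 * m + 3)! : ℝ) = (2 * m + 3 : ℝ) * (2 * m + 2 : ℝ) * (2 * m + 1 : ℝ) * ((2 * m)! : ℝ) := by
    rw [show 2 * m + 3 = (2 * m + 2) + 1 from rfl, fac_succ_real, g2]; push_cast; ring
  have g4 : ((2 * m + 4)! : ℝ) =
      (2 * m + 4 : ℝ) * (2 * m + 3 : ℝ) * (2 * m + 2 : ℝ) * (2 * m + 1 : ℝ) * ((2 * m)! : ℝ) := by
    rw [show 2 * m + 4 = (2 * m + 3) + 1 from rfl, fac_succ_real, g3]; push_cast; ring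
  have g5 : ((2 * m + 5)! : ℝ) =
      (2 * m + 5 : ℝ) * (2 * m + 4 : ℝ) * (2 * m + 3 : ℝ) * (2 * m + 2 : ℝ) * (2 * m + 1 : ℝ) * ((2 * m)! : ℝ) := by
    rw [show 2 * m + 5 = (2 * m + 4) + 1 from rfl, fac_succ_real, g4]; push_cast; ring
  have g6 : ((2 * m + 6)! : ℝ) =
      (2 * m + 6 : ℝ) * (2 * m + 5 : ℝ) * (2 * m + 4 : ℝ) * (2 * m + 3 : ℝ) * (2 * m + 2 : ℝ) * (2 * m + 1 : ℝ) *
        ((2 * m)! : ℝ) := by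
    rw [show 2 * m + 6 = (2 * m + 5) + 1 from rfl, fac_succ_real, g5]; push_cast; ring
  rw [f2, f3, g4, g6]
  have hm0 : ((m)! : ℝ) ≠ 0 := by positivity
  have hg0 : ((2 * m)! : ℝ) ≠ 0 := by positivity
  have hx0 : xiMoment (2 * m) ≠ 0 := (xiMoment_pos _).ne'
  have hx4 : xiMoment (2 * m + 4) ≠ 0 := (xiMoment_pos _).ne'
  have hx6 : xiMoment (2 * m + 6) ≠ 0 := (xiMoment_pos _).ne'
  have h4p : (4 : ℝ) ^ m ≠ 0 := by positivity
  have l1 : ((m : ℝ) + 1) ≠ 0 := by positivity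
  have l2 : ((m : ℝ) + 2) ≠ 0 := by positivity
  have l3 : ((m : ℝ) + 3) ≠ 0 := by positivity
  have k1 : (2 * (m : ℝ) + 1) ≠ 0 := by positivity
  have k2 : (2 * (m : ℝ) + 2) ≠ 0 := by positivity
  have k3 : (2 * (m : ℝ) + 3) ≠ 0 := by positivity
  have k4 : (2 * (m : ℝ) + 4) ≠ 0 := by positivity
  have k5 : (2 * (m : ℝ) + 5) ≠ 0 := by positivity
  have k6 : (2 * (m : ℝ) + 6) ≠ 0 := by positivity
  rw [show (4 : ℝ) ^ (m + 2) = 4 ^ m * 16 by ring, show (4 : ℝ) ^ (m + 3) = 4 ^ m * 64 by ring]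
  field_simp
  ring

/-- **δ-structure** (theory g7): `2MΔ(M)² = 1 + 1/(2b) − ((b−1)/b)·V`, `b = m + 5/2`, `M = m + 3`,
`V = M·(m₂m₀/m₁² − 1)`. -/
theorem delta_structure (m : ℕ) :
    2 * ((m : ℝ) + 3) * gorttwDeltaSq xiTaylorCoeff (m + 3) =
      1 + 1 / (2 * ((m : ℝ) + 5 / 2)) - (((m : ℝ) + 3 / 2) / ((m : ℝ) + 5 / 2)) *
        (((m : ℝ) + 3) * (xiMoment (2 * m + 2) * xiMoment (2 * m + 6) / xiMoment (2 * m + 4) ^ 2 - 1)) := by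
  unfold gorttwDeltaSq
  rw [windowSeqDown_two_xi]
  have hx4 : xiMoment (2 * m + 4) ≠ 0 := (xiMoment_pos _).ne'
  have hb : ((m : ℝ) + 5 / 2) ≠ 0 := by positivity
  have hb' : (2 * (m : ℝ) + 5) ≠ 0 := by positivity
  field_simp
  ring

/-- **skewness structure** (theory g7): `b²ũ₃ = 2 − 6((b−1)/M)·V + K`, `K = (m+3/2)(m+1/2)κ₃`. -/
theorem skewWindow_structure (m : ℕ) :
    ((m : ℝ) + 5 / 2) ^ 2 * gorttwU3 xiTaylorCoeff (m + 3) =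
      2 - 6 * (((m : ℝ) + 3 / 2) / ((m : ℝ) + 3)) *
        (((m : ℝ) + 3) * (xiMoment (2 * m + 2) * xiMoment (2 * m + 6) / xiMoment (2 * m + 4) ^ 2 - 1)) +
      ((m : ℝ) + 3 / 2) * ((m : ℝ) + 1 / 2) *
        ((xiMoment (2 * m) * xiMoment (2 * m + 6) ^ 2 - 3 * xiMoment (2 * m + 2) * xiMoment (2 * m + 4) * xiMoment (2 * m + 6)
          + 2 * xiMoment (2 * m + 4) ^ 3) / xiMoment (2 * m + 4) ^ 3) := by
  unfold gorttwU3
  rw [windowSeqDown_two_xi, windowSeqDown_three_xi]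
  have hx4 : xiMoment (2 * m + 4) ≠ 0 := (xiMoment_pos _).ne'
  have hb' : (2 * (m : ℝ) + 5) ≠ 0 := by positivity
  have l3 : ((m : ℝ) + 3) ≠ 0 := by positivity
  field_simp
  ring

/-- `ũ₃ = r̃₃ − 3r̃₂ + 2 = gorttwU3` as the third window cumulant (theory g7's `windowCumulant_three`). -/
theorem windowCumulant_three {γ : ℕ → ℝ} {M : ℕ} (hM1 : γ (M - 1) ≠ 0) :
    windowCumulant γ M 3 = gorttwU3 γ M := by
  rw [show (3 : ℕ) = 2 + 1 from rfl, windowCumulant]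
  simp only [Fin.sum_univ_two, Fin.val_zero, Fin.val_one, Nat.choose_zero_right, Nat.cast_one, one_mul,
    Nat.sub_zero, zero_add]
  rw [show (2 : ℕ) + 1 = 3 from rfl, show (1 : ℕ) + 1 = 2 from rfl, show (2 : ℕ) - 1 = 1 from rfl,
    Cumulant.windowCumulant_one hM1, Cumulant.windowCumulant_two hM1]
  have h1 : windowSeqDown γ M 1 = 1 := by unfold windowSeqDown; simp [hM1]
  have hc : ((Nat.choose 2 1 : ℕ) : ℝ) = 2 := by norm_num
  rw [h1, hc]
  unfold gorttwU3 gorttwDeltaSq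
  ring

/-! ## 2. Composition -/

/-- Final numeric inequality of the composition: for `0 ≤ z ≤ 1/38.8`,
`8·(1 + 10⁻¹⁸)⁴·(2.07 − 11.88 z)² ≤ (81/2)·(1 − 2.01 z)³`. -/
theorem aux_q {z : ℝ} (hz0 : 0 ≤ z) (hz1 : z ≤ 20 / 776) :
    8 * (1 + 1e-18) ^ 4 * (2.07 - 11.88 * z) ^ 2 ≤ 81 / 2 * (1 - 2.01 * z) ^ 3 := by
  nlinarith [mul_nonneg hz0 hz0, mul_nonneg (mul_nonneg hz0 hz0) hz0]

set_option maxHeartbeats 800000 in -- interval bookkeeping, no search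
/-- **The far skewness cap, composed**: `q(M) = M·Ũ₃(M)² ≤ 81/2` for every `M ≥ 2·10¹⁸`. -/
theorem q_le (M : ℕ) (hM : 2 * 10 ^ 18 ≤ M) : (M : ℝ) * hermiteCumulant xiTaylorCoeff M 3 ^ 2 ≤ 81 / 2 := by
  obtain ⟨m, rfl⟩ : ∃ m, M = m + 3 := ⟨M - 3, by omega⟩
  obtain ⟨a, ha, hVup, hVlo, hK0, hK1⟩ := far_interface m hM
  set V := ((m : ℝ) + 3) * (xiMoment (2 * m + 2) * xiMoment (2 * m + 6) / xiMoment (2 * m + 4) ^ 2 - 1) with hV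
  set K := ((m : ℝ) + 3 / 2) * ((m : ℝ) + 1 / 2) *
    ((xiMoment (2 * m) * xiMoment (2 * m + 6) ^ 2 - 3 * xiMoment (2 * m + 2) * xiMoment (2 * m + 4) * xiMoment (2 * m + 6)
      + 2 * xiMoment (2 * m + 4) ^ 3) / xiMoment (2 * m + 4) ^ 3) with hK
  set z : ℝ := 1 / (4 * a + 1) with hz
  have ha1 : 0 < 4 * a + 1 := by linarith
  have hz0 : 0 ≤ z := by positivity
  have hz1 : z ≤ 20 / 776 := by
    rw [hz, div_le_div_iff₀ ha1 (by norm_num)]; linarith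
  have hVup' : V ≤ 2.01 * z := by rw [hz]; rw [mul_one_div]; exact hVup
  have hVlo' : 1.99 * z ≤ V := by rw [hz]; rw [mul_one_div]; exact hVlo
  have hmR : (2 * 10 ^ 18 : ℝ) ≤ (m : ℝ) + 3 := by exact_mod_cast hM
  set b : ℝ := (m : ℝ) + 5 / 2 with hb
  have hb0 : 0 < b := by positivity
  -- δ and X
  have hδ := delta_structure m
  have hX := skewWindow_structure m
  rw [← hV] at hδ hX
  rw [← hK] at hX
  set δ := 2 * ((m : ℝ) + 3) * gorttwDeltaSq xiTaylorCoeff (m + 3) with hδdef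
  set X := ((m : ℝ) + 5 / 2) ^ 2 * gorttwU3 xiTaylorCoeff (m + 3) with hXdef
  have hVnn : 0 ≤ V := by linarith
  have hratio1 : ((m : ℝ) + 3 / 2) / ((m : ℝ) + 5 / 2) ≤ 1 := by
    rw [div_le_one (by positivity)]; linarith
  have hratio0 : 0 ≤ ((m : ℝ) + 3 / 2) / ((m : ℝ) + 5 / 2) := by positivity
  have hδlo : 1 - 2.01 * z ≤ δ := by
    rw [hδ]
    have h1 : 0 ≤ 1 / (2 * ((m : ℝ) + 5 / 2)) := by positivity
    have h2 : ((m : ℝ) + 3 / 2) / ((m : ℝ) + 5 / 2) * V ≤ 1 * V := mul_le_mul_of_nonneg_right hratio1 hVnn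
    linarith
  have hδpos : 0 < δ := by
    have : 2.01 * z ≤ 2.01 * (20 / 776) := by linarith
    linarith
  have hr2lo : 1 - 1e-18 ≤ ((m : ℝ) + 3 / 2) / ((m : ℝ) + 3) := by
    rw [le_div_iff₀ (by positivity)]; linarith [hmR]
  have hr2hi : ((m : ℝ) + 3 / 2) / ((m : ℝ) + 3) ≤ 1 := by
    rw [div_le_one (by positivity)]; linarith
  have hXhi : X ≤ 2.07 - 11.88 * z := by
    rw [hX]
    have h2 : (1 - 1e-18) * (1.99 * z) ≤ ((m : ℝ) + 3 / 2) / ((m : ℝ) + 3) * V :=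
      mul_le_mul hr2lo hVlo' (by positivity) (by linarith)
    linarith [h2, hK1, hz0]
  have hXlo : 0 < X := by
    rw [hX]
    have h2 : ((m : ℝ) + 3 / 2) / ((m : ℝ) + 3) * V ≤ 1 * (2.01 * z) :=
      mul_le_mul hr2hi hVup' hVnn zero_le_one
    have h3 : 2.01 * z ≤ 2.01 * (20 / 776) := by linarith
    linarith [h2, h3, hK0]
  -- the cumulant in terms of X and δ
  have hγ : xiTaylorCoeff (m + 3 - 1) ≠ 0 := (xiTaylorCoeff_pos_holds _).ne'
  have hΔ : gorttwDeltaSq xiTaylorCoeff (m + 3) = δ / (2 * ((m : ℝ) + 3)) := by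
    rw [hδdef]; field_simp
  have hΔpos : 0 < gorttwDeltaSq xiTaylorCoeff (m + 3) := by rw [hΔ]; positivity
  have hU : gorttwU3 xiTaylorCoeff (m + 3) = X / b ^ 2 := by
    rw [hXdef, hb]; field_simp
  have hq : ((m + 3 : ℕ) : ℝ) * hermiteCumulant xiTaylorCoeff (m + 3) 3 ^ 2 =
      8 * X ^ 2 * (((m : ℝ) + 3) / b) ^ 4 / δ ^ 3 := by
    unfold hermiteCumulant gorttwDelta
    rw [windowCumulant_three hγ, hU, div_pow, ← pow_mul, show 3 * 2 = 6 from rfl,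
      show Real.sqrt (gorttwDeltaSq xiTaylorCoeff (m + 3)) ^ 6 = (Real.sqrt (gorttwDeltaSq xiTaylorCoeff (m + 3)) ^ 2) ^ 3
        by ring, Real.sq_sqrt hΔpos.le, hΔ]
    push_cast
    field_simp
    ring
  rw [hq]
  -- `(M/b)⁴ ≤ (1 + 10⁻¹⁸)⁴`
  have hMb : ((m : ℝ) + 3) / b ≤ 1 + 1e-18 := by
    rw [div_le_iff₀ hb0, hb]; linarith [hmR]
  have hMb0 : 0 ≤ ((m : ℝ) + 3) / b := by positivity
  have hMb4 : (((m : ℝ) + 3) / b) ^ 4 ≤ (1 + 1e-18) ^ 4 := pow_le_pow_left₀ hMb0 hMb 4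
  have hX2 : X ^ 2 ≤ (2.07 - 11.88 * z) ^ 2 := pow_le_pow_left₀ hXlo.le hXhi 2
  have hz2 : 0 < 1 - 2.01 * z := by linarith [hz1]
  have hδ3 : (1 - 2.01 * z) ^ 3 ≤ δ ^ 3 := pow_le_pow_left₀ hz2.le hδlo 3
  rw [div_le_iff₀ (pow_pos hδpos 3)]
  calc 8 * X ^ 2 * (((m : ℝ) + 3) / b) ^ 4 ≤ 8 * (2.07 - 11.88 * z) ^ 2 * (1 + 1e-18) ^ 4 :=
        mul_le_mul (mul_le_mul_of_nonneg_left hX2 (by norm_num)) hMb4 (by positivity) (by positivity)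
    _ = 8 * (1 + 1e-18) ^ 4 * (2.07 - 11.88 * z) ^ 2 := by ring
    _ ≤ 81 / 2 * (1 - 2.01 * z) ^ 3 := aux_q hz0 hz1
    _ ≤ 81 / 2 * δ ^ 3 := mul_le_mul_of_nonneg_left hδ3 (by norm_num)

/-- **Item closer** (route `JensenPolynomials`, FAR crux child `XiCumulantSkew98Far`, stmt-RiemannHypothesis-19466):
`q(M) = M·Ũ₃(M)² ≤ 81/2` for every `M ≥ 2·10¹⁸` — RH-FREE, zero-free, height-free. -/
theorem xiCumulantSkew98Far_item : Summit.RiemannHypothesis.RiemannHypothesis.Theses.JensenPolynomials.XiCumulantSkew98Far :=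
  fun M hM => q_le M hM

end Summit.RiemannHypothesis.RiemannHypothesis.Theorems.JensenPolynomials.SkewFar

end
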